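import Literature.AlgebraicGeometry.AbelianSchemes.AbelianSchemeOverBase
import Literature.AlgebraicGeometry.AbelianSchemes.AbelianSchemeOverField
import HarnessLib

/-!
# An abelian scheme is geometrically integral over its base

Layer `Literature/AlgebraicGeometry/AbelianSchemes`, namespace `Literature.AlgebraicGeometry.AbelianSchemes.AbelianSchemeOver`.
THEOREMS ONLY (no definition, no instance, no notation, no named fact, no `sorry`).  Cell `hodgecm-mathlib` (D-0151),
count-neutral capital (author B-p05 (g16)).  HC_CM is proved only modulo the 7 printed citations until rung 0 closes; this
file asserts nothing about HC.

For an abelian scheme `A → S` over an ARBITRARY base ([MumfordFogartyKirwan1994] Ch. 6 §1 Definition 6.1: smooth proper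
group scheme with geometrically connected fibres) the structure morphism is GEOMETRICALLY INTEGRAL in Mathlib's sense
(`GeometricallyIntegral f`: every base change to a field is an integral scheme): by Mathlib
`GeometricallyIntegral.iff_geometricallyIntegral_fiber` it suffices to treat the fibres `A_s → Spec κ(s)`, which are
abelian schemes over fields (★ `AbelianSchemeOver.fibre`), geometrically integral by ★ `AbelianScheme.geometricallyIntegral_hom`
([GortzWedhorn2020] Cor. 16.52 / Remark 16.54: a connected smooth group scheme over a field is geometrically integral).
This discharges the standing hypothesis `[GeometricallyIntegral A.X.hom]` of the relative-seesaw consumers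
(★ `AbelianSchemeKOfLSeesaw`, ★ `AbelianSchemeKOfLFinite`).

* `geometricallyIntegral_hom_overBase` — `GeometricallyIntegral A.X.hom` (the `AbelianSchemeOver S` form of the field case
  ★ `AbelianScheme.geometricallyIntegral_hom`);
* `geometricallyIrreducible_hom_overBase`, `geometricallyReduced_hom_overBase` — the two halves;
* `isIntegral_pullback_of_field` — `A ×_S Spec K` is an integral scheme for every field-valued point `Spec K → S`.

## References
* [MumfordFogartyKirwan1994] D. Mumford, J. Fogarty, F. Kirwan, *Geometric Invariant Theory*, 3rd ed. (1994), Ch. 6 §1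
  Definition 6.1 (p. 115).
* [GortzWedhorn2020] U. Görtz, T. Wedhorn, *Algebraic Geometry I*, 2nd ed. (2020), Cor. 16.52 (p. 539), Remark 16.54 (p. 539).
-/

noncomputable section

universe u

open CategoryTheory CategoryTheory.Limits AlgebraicGeometry

namespace Literature.AlgebraicGeometry.AbelianSchemes

namespace AbelianSchemeOver

variable {S : Scheme.{u}} (𝒜 : AbelianSchemeOver S)

/-- **An abelian scheme is geometrically integral over its base**: every base change of `A → S` to a field is an integral
scheme (fibrewise by Mathlib `GeometricallyIntegral.iff_geometricallyIntegral_fiber`; each fibre `A_s / κ(s)` is an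
abelian scheme over a field, ★ `AbelianScheme.geometricallyIntegral_hom`).
[cite: GortzWedhorn2020, Cor. 16.52 (p. 539) and Remark 16.54 (p. 539)] [cite: MumfordFogartyKirwan1994, Ch. 6 §1 Definition 6.1 (p. 115)] -/
theorem geometricallyIntegral_hom_overBase : GeometricallyIntegral 𝒜.X.hom :=
  (GeometricallyIntegral.iff_geometricallyIntegral_fiber 𝒜.X.hom).2 fun s =>
    (𝒜.fibre (S.fromSpecResidueField s)).geometricallyIntegral_hom

/-- An abelian scheme is geometrically irreducible over its base. [cite: GortzWedhorn2020, Cor. 16.52 (p. 539) and Remark 16.54 (p. 539)] -/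
theorem geometricallyIrreducible_hom_overBase : GeometricallyIrreducible 𝒜.X.hom :=
  haveI := 𝒜.geometricallyIntegral_hom_overBase
  inferInstance

/-- An abelian scheme is geometrically reduced over its base. [cite: GortzWedhorn2020, Cor. 16.52 (p. 539) and Remark 16.54 (p. 539)] -/
theorem geometricallyReduced_hom_overBase : GeometricallyReduced 𝒜.X.hom :=
  haveI := 𝒜.geometricallyIntegral_hom_overBase
  inferInstance

/-- **`A ×_S Spec K` is an integral scheme** for every field-valued point `Spec K → S` of the base.
[cite: GortzWedhorn2020, Cor. 16.52 (p. 539) and Remark 16.54 (p. 539)] -/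
theorem isIntegral_pullback_of_field {K : Type u} [Field K] (y : Spec (.of K) ⟶ S) : IsIntegral (pullback 𝒜.X.hom y) :=
  haveI := 𝒜.geometricallyIntegral_hom_overBase
  haveI : GeometricallyIntegral (pullback.snd 𝒜.X.hom y) := inferInstance
  GeometricallyIntegral.isIntegral_of_subsingleton (pullback.snd 𝒜.X.hom y)

end AbelianSchemeOver

end Literature.AlgebraicGeometry.AbelianSchemes

end
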